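import Mathlib
import Summits.NavierStokesRegularity.FluidComputer.AbcInertiaHeadForm

/-!
# INERTIA-3L instantiation, Part 5a: the WEIGHT OPERATOR `G = GH ⊕ 1` on `ℓ²(Idx, ℂ)`, its symmetry, the
# test vectors, and the counting hypothesis from (R2) (instab3 g8, cell `ns-blowup`, 2026-08-27)

HONEST FRAMING (human ruling D-0035): nothing here is a claim about Navier–Stokes blow-up.
WHAT THIS IS NOT: not NS evidence. MODEL lane (forced-ABC linearisation, class II, coordinates of
`AbcClassIIDefs`); no certificate, number or census word moves.

The Hilbert space of the INERTIA-3L instantiation is `E = ℓ²(Idx, ℂ)` (square-summable class-II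
coordinate vectors; `⟪f, g⟫ = Σ' conj(f_i) g_i`). For a finite junction head `H : Finset Idx` and a real
symmetric head weight `GH` on `H` this file constructs, as existence statements with their defining
formulas (no new definitions):
* `exists_weightOp` — the bounded weight `(G f)_i = Σ_{j ∈ H} GH i j f_j` (`i ∈ H`), `f_i` (`i ∉ H`), a
  complex-linear endomorphism of `ℓ²` with `⟪G f, g⟫ = ⟪f, G g⟫` (hypothesis `hG` of
  `LyapunovInertiaCount.finrank_le_of_generator_form_neg`, instab3 g7 p493094);
* `exists_testVec` — the vectors `e_μ = (V_{i μ})_{i ∈ H} ⊕ 0`, `μ < m`;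
* `weight_form_nonneg_of_orthogonal` — **(R2) ⇒ the counting hypothesis `hK`**: if
  `x ⬝ ((GH + V Vᵀ) x) ≥ 0` for all real `x` on `H`, then `Re ⟪G x, x⟫ ≥ 0` for every `x ∈ ℓ²` orthogonal to
  the `e_μ` (real and imaginary parts separately; the tail contributes `Σ_{i ∉ H} |x_i|² ≥ 0`).
§1 collects the `ℓ²` bookkeeping (`Memℓp` ⇄ square-summability, the inner product as a series).

Mathlib + `AbcInertiaHeadForm` (for `re_sum_conj_mul_sum`); no new definitions; std axioms. [folklore]
-/

noncomputable section

open scoped BigOperators ComplexConjugate Matrix InnerProductSpace lp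
open Finset Matrix

namespace Summit.NavierStokesRegularity.FluidComputer.AbcInertia

open Literature.Analysis.FunctionSpaces Literature.Analysis.FunctionSpaces.Torus
open Literature.Analysis.FluidPDE
open Summit.NavierStokesRegularity.FluidComputer.AbcClassII

/-! ### §1 `ℓ²(Idx, ℂ)` tools -/

/-- Square-summable coordinate vectors are in `ℓ²`. -/
theorem memℓp_two_of_summable_sq {x : Idx → ℂ} (h : Summable fun i : Idx => ‖x i‖ ^ 2) : Memℓp x 2 := by
  refine memℓp_gen ?_
  refine h.congr fun i => ?_
  rw [ENNReal.toReal_ofNat, Real.rpow_two]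

/-- `ℓ²` vectors are square-summable. -/
theorem summable_sq_of_memℓp {x : Idx → ℂ} (h : Memℓp x 2) : Summable fun i : Idx => ‖x i‖ ^ 2 := by
  have := h.summable (by norm_num)
  refine this.congr fun i => ?_
  rw [ENNReal.toReal_ofNat, Real.rpow_two]

/-- Finitely supported vectors are in `ℓ²`. -/
theorem memℓp_two_of_support {x : Idx → ℂ} (S : Finset Idx) (h : ∀ i ∉ S, x i = 0) : Memℓp x 2 :=
  memℓp_two_of_summable_sq (summable_of_ne_finset_zero (s := S) fun i hi => by rw [h i hi]; simp)

/-- Rapidly decaying vectors are square-summable. -/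
theorem summable_sq_of_rapid {x : Idx → ℂ}
    (hx : ∀ s : ℕ, Summable fun i : Idx => (1 + onormSq i.1) ^ s * ‖x i‖ ^ 2) :
    Summable fun i : Idx => ‖x i‖ ^ 2 := by
  simpa using hx 0

/-- Rapidly decaying vectors lie in the graph class. -/
theorem summable_weight_of_rapid {x : Idx → ℂ}
    (hx : ∀ s : ℕ, Summable fun i : Idx => (1 + onormSq i.1) ^ s * ‖x i‖ ^ 2) :
    Summable fun i : Idx => (1 + onormSq i.1) * ‖x i‖ ^ 2 := by
  simpa using hx 1

/-- The inner product of `ℓ²(Idx, ℂ)` as the series `Σ' conj(f_i) g_i`. -/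
theorem inner_eq_tsum_conj_mul (f g : ℓ²(Idx, ℂ)) :
    ⟪f, g⟫_ℂ = ∑' i : Idx, (starRingEnd ℂ) (f i) * g i := by
  rw [lp.inner_eq_tsum]
  exact tsum_congr fun i => by rw [RCLike.inner_apply, mul_comm]

/-- The inner-product series `conj(f_i) g_i` is summable. -/
theorem summable_conj_mul (f g : ℓ²(Idx, ℂ)) : Summable fun i : Idx => (starRingEnd ℂ) (f i) * g i := by
  have := lp.summable_inner (𝕜 := ℂ) f g
  exact this.congr fun i => by rw [RCLike.inner_apply, mul_comm]

/-! ### §2 The weight operator `G = GH ⊕ 1` and the test vectors -/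

section Weight

variable {HH : Finset Idx}

/-- **The weight operator** `(G f)_i = Σ_{j ∈ H} GH i j f_j` (`i ∈ H`), `f_i` (`i ∉ H`) exists as a linear
endomorphism of `ℓ²(Idx, ℂ)` and is SYMMETRIC for `GHᵀ = GH`. -/
theorem exists_weightOp (GH : Matrix ↥HH ↥HH ℝ) (hGH : GHᵀ = GH) :
    ∃ G : ℓ²(Idx, ℂ) →ₗ[ℂ] ℓ²(Idx, ℂ),
      (∀ (f : ℓ²(Idx, ℂ)) (i : Idx),
        G f i = if h : i ∈ HH then ∑ j : ↥HH, ((GH ⟨i, h⟩ j : ℝ) : ℂ) * f j.1 else f i) ∧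
      (∀ f g : ℓ²(Idx, ℂ), ⟪G f, g⟫_ℂ = ⟪f, G g⟫_ℂ) := by
  classical
  -- the underlying function, its linearity and its membership in ℓ²
  set Gfun : (Idx → ℂ) → (Idx → ℂ) := fun x i =>
    if h : i ∈ HH then ∑ j : ↥HH, ((GH ⟨i, h⟩ j : ℝ) : ℂ) * x j.1 else x i with hGfun
  have hGfun_add : ∀ x y : Idx → ℂ, Gfun (x + y) = Gfun x + Gfun y := by
    intro x y; funext i
    by_cases h : i ∈ HH
    · simp only [hGfun, dif_pos h, Pi.add_apply, mul_add, Finset.sum_add_distrib]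
    · simp only [hGfun, dif_neg h, Pi.add_apply]
  have hGfun_smul : ∀ (c : ℂ) (x : Idx → ℂ), Gfun (c • x) = c • Gfun x := by
    intro c x; funext i
    by_cases h : i ∈ HH
    · simp only [hGfun, dif_pos h, Pi.smul_apply, smul_eq_mul, Finset.mul_sum]
      exact Finset.sum_congr rfl fun j _ => by ring
    · simp only [hGfun, dif_neg h, Pi.smul_apply, smul_eq_mul]
  have hmem : ∀ f : ℓ²(Idx, ℂ), Memℓp (Gfun f) 2 := by
    intro f
    have hc : Memℓp (fun i : Idx => Gfun f i - f i) 2 :=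
      memℓp_two_of_support HH fun i hi => by simp [hGfun, dif_neg hi]
    have heq : Gfun f = (⇑f) + fun i : Idx => Gfun f i - f i := by
      funext i; simp
    rw [heq]
    exact (lp.memℓp f).add hc
  refine ⟨{ toFun := fun f => ⟨Gfun f, hmem f⟩, map_add' := fun f g => ?_, map_smul' := fun c f => ?_ },
    fun f i => rfl, ?_⟩
  · apply lp.ext
    change Gfun (⇑(f + g)) = Gfun ⇑f + Gfun ⇑g
    rw [lp.coeFn_add, hGfun_add]
  · apply lp.ext
    change Gfun (⇑(c • f)) = c • Gfun ⇑f
    rw [lp.coeFn_smul, hGfun_smul]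
  · -- symmetry
    intro f g
    change ⟪(⟨Gfun f, hmem f⟩ : ℓ²(Idx, ℂ)), g⟫_ℂ = ⟪f, (⟨Gfun g, hmem g⟩ : ℓ²(Idx, ℂ))⟫_ℂ
    rw [inner_eq_tsum_conj_mul, inner_eq_tsum_conj_mul]
    have hs1 := summable_conj_mul (⟨Gfun f, hmem f⟩ : ℓ²(Idx, ℂ)) g
    have hs2 := summable_conj_mul f (⟨Gfun g, hmem g⟩ : ℓ²(Idx, ℂ))
    rw [← sub_eq_zero, ← hs1.tsum_sub hs2]
    -- the difference is supported on `H`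
    have hsupp : ∀ i ∉ HH, (starRingEnd ℂ) ((⟨Gfun f, hmem f⟩ : ℓ²(Idx, ℂ)) i) * g i -
        (starRingEnd ℂ) (f i) * (⟨Gfun g, hmem g⟩ : ℓ²(Idx, ℂ)) i = 0 := by
      intro i hi
      change (starRingEnd ℂ) (Gfun f i) * g i - (starRingEnd ℂ) (f i) * Gfun g i = 0
      simp only [hGfun, dif_neg hi, sub_self]
    rw [tsum_eq_sum hsupp, ← Finset.sum_coe_sort HH]
    have e : ∀ i : ↥HH, (starRingEnd ℂ) ((⟨Gfun f, hmem f⟩ : ℓ²(Idx, ℂ)) i.1) * g i.1 -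
        (starRingEnd ℂ) (f i.1) * (⟨Gfun g, hmem g⟩ : ℓ²(Idx, ℂ)) i.1 =
        (starRingEnd ℂ) (∑ j : ↥HH, ((GH i j : ℝ) : ℂ) * f j.1) * g i.1 -
          (starRingEnd ℂ) (f i.1) * ∑ j : ↥HH, ((GH i j : ℝ) : ℂ) * g j.1 := by
      intro i
      change (starRingEnd ℂ) (Gfun f i.1) * g i.1 - (starRingEnd ℂ) (f i.1) * Gfun g i.1 = _
      simp only [hGfun, dif_pos i.2]
    rw [Finset.sum_congr rfl fun i _ => e i, Finset.sum_sub_distrib]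
    -- both double sums are `Σ_i Σ_j GH i j conj(f_j) g_i` after a swap
    have h1 : ∑ i : ↥HH, (starRingEnd ℂ) (∑ j : ↥HH, ((GH i j : ℝ) : ℂ) * f j.1) * g i.1 =
        ∑ i : ↥HH, ∑ j : ↥HH, ((GH i j : ℝ) : ℂ) * (starRingEnd ℂ) (f j.1) * g i.1 := by
      refine Finset.sum_congr rfl fun i _ => ?_
      rw [map_sum, Finset.sum_mul]
      refine Finset.sum_congr rfl fun j _ => ?_
      rw [map_mul, Complex.conj_ofReal]
    have h2 : ∑ i : ↥HH, (starRingEnd ℂ) (f i.1) * ∑ j : ↥HH, ((GH i j : ℝ) : ℂ) * g j.1 =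
        ∑ i : ↥HH, ∑ j : ↥HH, ((GH i j : ℝ) : ℂ) * (starRingEnd ℂ) (f j.1) * g i.1 := by
      rw [Finset.sum_comm]
      refine Finset.sum_congr rfl fun j _ => ?_
      rw [Finset.mul_sum]
      refine Finset.sum_congr rfl fun i _ => ?_
      have hji : GH j i = GH i j := by
        have := congrFun (congrFun hGH i) j
        rwa [Matrix.transpose_apply] at this
      rw [hji]; ring
    rw [h1, h2, sub_self]

/-- **The test vectors** `e_μ = (V_{i μ})_{i ∈ H} ⊕ 0` exist in `ℓ²(Idx, ℂ)`. -/
theorem exists_testVec {m : ℕ} (V : Matrix ↥HH (Fin m) ℝ) :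
    ∃ e : Fin m → ℓ²(Idx, ℂ), ∀ (μ : Fin m) (i : Idx),
      e μ i = if h : i ∈ HH then ((V ⟨i, h⟩ μ : ℝ) : ℂ) else 0 := by
  classical
  refine ⟨fun μ => ⟨fun i => if h : i ∈ HH then ((V ⟨i, h⟩ μ : ℝ) : ℂ) else 0,
    memℓp_two_of_support HH fun i hi => by simp [dif_neg hi]⟩, fun μ i => rfl⟩

/-- **The counting hypothesis from (R2).** If `x ⬝ ((GH + V Vᵀ) x) ≥ 0` for all real `x` on `H`, then
`Re ⟪G x, x⟫ ≥ 0` for every `x ∈ ℓ²` orthogonal to the test vectors `e_μ`. -/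
theorem weight_form_nonneg_of_orthogonal {m : ℕ} (GH : Matrix ↥HH ↥HH ℝ) (V : Matrix ↥HH (Fin m) ℝ)
    (hR2 : ∀ u : ↥HH → ℝ, 0 ≤ u ⬝ᵥ ((GH + V * Vᵀ) *ᵥ u))
    (G : ℓ²(Idx, ℂ) →ₗ[ℂ] ℓ²(Idx, ℂ))
    (hG : ∀ (f : ℓ²(Idx, ℂ)) (i : Idx),
      G f i = if h : i ∈ HH then ∑ j : ↥HH, ((GH ⟨i, h⟩ j : ℝ) : ℂ) * f j.1 else f i)
    (e : Fin m → ℓ²(Idx, ℂ))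
    (he : ∀ (μ : Fin m) (i : Idx), e μ i = if h : i ∈ HH then ((V ⟨i, h⟩ μ : ℝ) : ℂ) else 0)
    (x : ℓ²(Idx, ℂ)) (hx : ∀ μ, ⟪e μ, x⟫_ℂ = 0) : 0 ≤ (⟪G x, x⟫_ℂ).re := by
  classical
  -- real and imaginary parts of the head coordinates
  set u : ↥HH → ℝ := fun i => (x i.1).re with hu
  set v : ↥HH → ℝ := fun i => (x i.1).im with hv
  -- orthogonality: `Vᵀ u = 0 = Vᵀ v`
  have hVu : Vᵀ *ᵥ u = 0 ∧ Vᵀ *ᵥ v = 0 := by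
    have hμ : ∀ μ : Fin m, (∑ i : ↥HH, ((V i μ : ℝ) : ℂ) * x i.1) = 0 := by
      intro μ
      have h := hx μ
      rw [inner_eq_tsum_conj_mul] at h
      have hsupp : ∀ i ∉ HH, (starRingEnd ℂ) (e μ i) * x i = 0 := fun i hi => by
        rw [he, dif_neg hi, map_zero, zero_mul]
      rw [tsum_eq_sum hsupp, ← Finset.sum_coe_sort HH] at h
      rw [← h]
      refine Finset.sum_congr rfl fun i _ => ?_
      rw [he, dif_pos i.2, Complex.conj_ofReal]
    constructor
    · funext μ
      have h := congrArg Complex.re (hμ μ)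
      simp only [Complex.re_sum, Complex.mul_re, Complex.ofReal_re, Complex.ofReal_im, zero_mul,
        sub_zero, Complex.zero_re] at h
      simpa [Matrix.mulVec, dotProduct, Matrix.transpose_apply, hu] using h
    · funext μ
      have h := congrArg Complex.im (hμ μ)
      simp only [Complex.im_sum, Complex.mul_im, Complex.ofReal_re, Complex.ofReal_im, zero_mul,
        add_zero, Complex.zero_im] at h
      simpa [Matrix.mulVec, dotProduct, Matrix.transpose_apply, hv] using h
  -- `u ⬝ (GH u) ≥ 0` and `v ⬝ (GH v) ≥ 0`
  have hGu : 0 ≤ u ⬝ᵥ (GH *ᵥ u) := by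
    have h := hR2 u
    rwa [Matrix.add_mulVec, dotProduct_add, ← Matrix.mulVec_mulVec, hVu.1, Matrix.mulVec_zero,
      dotProduct_zero, add_zero] at h
  have hGv : 0 ≤ v ⬝ᵥ (GH *ᵥ v) := by
    have h := hR2 v
    rwa [Matrix.add_mulVec, dotProduct_add, ← Matrix.mulVec_mulVec, hVu.2, Matrix.mulVec_zero,
      dotProduct_zero, add_zero] at h
  -- split `⟪G x, x⟫` into head (finite) and tail (`Σ |x_i|²`)
  rw [inner_eq_tsum_conj_mul]
  set p : Idx → ℂ := fun i => (starRingEnd ℂ) (G x i) * x i with hp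
  set pH : Idx → ℂ := fun i => if i ∈ HH then p i else 0 with hpH
  set pT : Idx → ℂ := fun i => if i ∈ HH then 0 else (starRingEnd ℂ) (x i) * x i with hpT
  have hps : Summable p := summable_conj_mul (G x) x
  have hsplit : ∀ i, p i = pH i + pT i := by
    intro i
    by_cases hi : i ∈ HH
    · simp only [hpH, hpT, if_pos hi, add_zero]
    · simp only [hpH, hpT, if_neg hi, zero_add, hp, hG, dif_neg hi]
  have hpH_supp : ∀ i ∉ HH, pH i = 0 := fun i hi => by simp only [hpH, if_neg hi]
  have hpH_s : Summable pH := summable_of_ne_finset_zero hpH_supp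
  have hpT_s : Summable pT := by
    have := hps.sub hpH_s
    refine this.congr fun i => ?_
    rw [hsplit i]; ring
  rw [show (∑' i, p i) = ∑' i, (pH i + pT i) from tsum_congr hsplit, hpH_s.tsum_add hpT_s,
    Complex.add_re, tsum_eq_sum hpH_supp]
  -- tail: nonnegative
  have hT : 0 ≤ (∑' i, pT i).re := by
    rw [Complex.re_tsum hpT_s]
    refine tsum_nonneg fun i => ?_
    by_cases hi : i ∈ HH
    · simp only [hpT, if_pos hi, Complex.zero_re]; exact le_rfl
    · simp only [hpT, if_neg hi]
      rw [mul_comm, Complex.mul_conj, Complex.ofReal_re]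
      exact Complex.normSq_nonneg _
  -- head: `u ⬝ (GH u) + v ⬝ (GH v)`
  have hH : (∑ i ∈ HH, pH i).re = u ⬝ᵥ (GH *ᵥ u) + v ⬝ᵥ (GH *ᵥ v) := by
    rw [← Finset.sum_coe_sort HH]
    have e : ∀ i : ↥HH, pH i.1 =
        (starRingEnd ℂ) (∑ j : ↥HH, ((GH i j : ℝ) : ℂ) * x j.1) * ∑ j : ↥HH, (((1 : Matrix ↥HH ↥HH ℝ) i j : ℝ) : ℂ) * x j.1 := by
      intro i
      simp only [hpH, if_pos i.2, hp, hG, dif_pos i.2]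
      congr 1
      rw [Finset.sum_eq_single i]
      · rw [Matrix.one_apply_eq]; simp
      · intro j _ hji; rw [Matrix.one_apply_ne (Ne.symm hji)]; simp
      · intro h; exact absurd (Finset.mem_univ i) h
    rw [Finset.sum_congr rfl fun i _ => e i]
    -- hGH is not needed for this identity with `P = 1`: use the rectangular real form after the swap
    have hsw : ∑ i : ↥HH, (starRingEnd ℂ) (∑ j : ↥HH, ((GH i j : ℝ) : ℂ) * x j.1) *
        ∑ j : ↥HH, (((1 : Matrix ↥HH ↥HH ℝ) i j : ℝ) : ℂ) * x j.1 =
        ∑ i : ↥HH, (starRingEnd ℂ) (∑ j : ↥HH, ((GH i j : ℝ) : ℂ) * x j.1) * x i.1 := by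
      refine Finset.sum_congr rfl fun i _ => ?_
      congr 1
      rw [Finset.sum_eq_single i]
      · rw [Matrix.one_apply_eq]; simp
      · intro j _ hji; rw [Matrix.one_apply_ne (Ne.symm hji)]; simp
      · intro h; exact absurd (Finset.mem_univ i) h
    rw [hsw]
    -- `Σ_i conj(Σ_j GH_ij x_j) x_i = conj( Σ_i conj(x_i) Σ_j GH_ij x_j )`, real part unchanged
    have hconj : ∑ i : ↥HH, (starRingEnd ℂ) (∑ j : ↥HH, ((GH i j : ℝ) : ℂ) * x j.1) * x i.1 =
        (starRingEnd ℂ) (∑ i : ↥HH, (starRingEnd ℂ) (x i.1) * ∑ j : ↥HH, ((GH i j : ℝ) : ℂ) * x j.1) := by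
      rw [map_sum]
      refine Finset.sum_congr rfl fun i _ => ?_
      rw [map_mul, Complex.conj_conj, mul_comm]
    rw [hconj, Complex.conj_re, re_sum_conj_mul_sum GH (fun i : ↥HH => x i.1) (fun j : ↥HH => x j.1)]
  rw [hH]
  linarith

end Weight

end Summit.NavierStokesRegularity.FluidComputer.AbcInertia

end
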